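import Summits.ResolutionOfSingularities.ResolutionOfSingularities.Theorems.FrobeniusClosingSteerArithNearACone
import Mathlib.Algebra.CharP.Lemmas
import HarnessLib

/-!
# Crux `Steer` (stmt-ResolutionOfSingularities-16345), β-leaf debt K-β0(a) — lemma (R) RET-ID, part 2: the PARITY READING of the return identity
  (res-D-pv-053 g9; res-L0-w41-plan-1 RULING 317 (c); reader res-L0-w41-tri-1 g8; memo `D/res-D-pv-053/K-BETA0A-SCOPE.md` §4)

OURS (campaign `res-hironaka`, rung L ★L-G4, slot W4.1). Candidates' vocabulary made kernel; nothing here is a statement of H. Hironaka's manuscript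
[Hironaka2017] (status: under review). AI-written; AI review is weaker than expert review. Def-free, Theses-free, 0 sorries; pure polynomial algebra.

## What is proved («a square has no odd-degree part in characteristic two»)

Part 1 (`…ArithReturnId`, `ReturnId.returnIdentity`) gives, at a free return `B(u) → A′`, the identity `G₁ = W²·(f′ − h²) + V²` for the weak transform
`G₁` of the `u`-cofactor `G₀ ∈ 𝔪_j^d` of the B-stage; modulo `u`, in the polynomial local ring `R_{j′}/(u) = κ_j[T]_𝔫` (the chart presentation, as in
res-D-repro-2's bridge), this reads `q ≡ c·Ψ(T − a) + V² (mod 𝔫^(d+1))` with `q = (in_d G₀)(U := 1)` of degree `≤ d`, `Ψ(T − a)` the landing A-cone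
restricted to `U = 0` (rational landing point `a`), `c = w̄² ≠ 0`. This file extracts the cone-level consequence:

* `homogeneousComponent_sq_eq_zero_of_odd` — in characteristic two a square polynomial has no homogeneous component of ODD degree
  (`U² = Σ c_m² T^(2m)`).
* `homogeneousComponent_eq_of_sq_congr_origin` — `q − c·Ψ − V² ∈ (T)^(d+1)`, `Ψ` a form of odd degree `d` ⇒ the degree-`d` component of `q`
  IS `c·Ψ` (no degree bound on `q` needed).
* `homogeneousComponent_translate_eq_of_sq_congr` — the same at a rational point `a` (`eval a` kills `𝔮`): `q − c·Ψ(T − a) − V² ∈ 𝔮^(d+1)` ⇒ the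
  degree-`d` component of the translate `q(T + a)` is `c·Ψ`.
For the run (adapted coordinates, `a = 0`): the `U`-free part of the B-stage cone `in_d G₀` equals `w̄²·` (the A-landing cone restricted to `U = 0`) —
the exceptional-free parts of the two cones AGREE up to a unit across a free return, so the number of variables cannot drop (tri-1 §169d (ii)
«`Φ_{A′}|_{U=0} = Φ_A`»).

[cite: CossartJannsenSaito2020, §2.2 (p. 24)] [folklore]
-/

noncomputable section

-- `Summit.<S>.<S>.…` duplicates the summit name by design (single-problem summit).
set_option linter.dupNamespace false

open MvPolynomial
open Literature.AlgebraicGeometry.Resolution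

namespace Summit.ResolutionOfSingularities.ResolutionOfSingularities.Theorems.SwitchingDichotomy.ArithTransport

namespace ReturnId

open NonRationalWindow.BiConeForms NearA

/-! ## §1 Squares have no odd part in characteristic two -/

section Parity

variable {R : Type*} [CommRing R] [CharP R 2] {σ : Type*}

/-- In characteristic two, `U² = Σ_m c_m² · T^(2m)`. [folklore] -/
theorem sq_eq_sum_monomial_two_nsmul (U : MvPolynomial σ R) :
    U ^ 2 = ∑ m ∈ U.support, monomial (2 • m) (coeff m U ^ 2) := by
  classical
  haveI : ExpChar (MvPolynomial σ R) 2 := ExpChar.prime Nat.prime_two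
  conv_lhs => rw [U.as_sum]
  rw [sum_pow_char 2 U.support (fun m => monomial m (coeff m U))]
  refine Finset.sum_congr rfl fun m _ => ?_
  rw [monomial_pow]

/-- **A square has no homogeneous component of odd degree** (characteristic two). [folklore] -/
theorem homogeneousComponent_sq_eq_zero_of_odd (U : MvPolynomial σ R) {d : ℕ} (hd : Odd d) : homogeneousComponent d (U ^ 2) = 0 := by
  classical
  rw [sq_eq_sum_monomial_two_nsmul, map_sum]
  refine Finset.sum_eq_zero fun m _ => ?_
  have hmem : monomial (2 • m) (coeff m U ^ 2) ∈ homogeneousSubmodule σ R (2 * m.degree) := by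
    rw [mem_homogeneousSubmodule]
    refine isHomogeneous_monomial _ ?_
    rw [two_nsmul, map_add, two_mul]
  rw [homogeneousComponent_of_mem hmem, if_neg]
  intro h
  obtain ⟨r, hr⟩ := hd
  omega

end Parity

/-! ## §2 The degree-`d` component from a congruence modulo a square -/

section Reading

variable {k : Type*} [Field k] [CharP k 2] {σ : Type*}

/-- **Parity reading at the origin.** `q − c·Ψ − V² ∈ (T)^(d+1)` with `Ψ` a form of ODD degree `d` ⇒ the degree-`d` component of `q` is `c·Ψ`.
[cite: CossartJannsenSaito2020, §2.2 (p. 24)] -/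
theorem homogeneousComponent_eq_of_sq_congr_origin {d : ℕ} (hd : Odd d) {q V Ψ : MvPolynomial σ k} (hΨ : Ψ.IsHomogeneous d) (c : k)
    (h : q - C c * Ψ - V ^ 2 ∈ idealOfVars σ k ^ (d + 1)) : homogeneousComponent d q = C c * Ψ := by
  classical
  have h0 : homogeneousComponent d (q - C c * Ψ - V ^ 2) = 0 := by
    refine homogeneousComponent_eq_zero' d _ fun m hm => ?_
    rw [mem_pow_idealOfVars_iff] at h
    have := h m hm
    omega
  have hΨc : homogeneousComponent d (C c * Ψ) = C c * Ψ := by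
    have hmem : C c * Ψ ∈ homogeneousSubmodule σ k d := by
      rw [mem_homogeneousSubmodule]
      simpa using (isHomogeneous_C σ c).mul hΨ
    rw [homogeneousComponent_of_mem hmem, if_pos rfl]
  rw [map_sub, map_sub, hΨc, homogeneousComponent_sq_eq_zero_of_odd V hd, sub_zero, sub_eq_zero] at h0
  exact h0

/-- **Parity reading at a rational point.** If `eval a` kills the ideal `𝔮` and `q − c·Ψ(T − a) − V² ∈ 𝔮^(d+1)` with `Ψ` a form of odd degree `d`,
then the degree-`d` component of the translate `q(T + a)` is `c·Ψ`. [cite: CossartJannsenSaito2020, §2.2 (p. 24)] -/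
theorem homogeneousComponent_translate_eq_of_sq_congr (𝔮 : Ideal (MvPolynomial σ k)) (a : σ → k) (hrat : ∀ f ∈ 𝔮, eval a f = 0)
    {d : ℕ} (hd : Odd d) {q V Ψ : MvPolynomial σ k} (hΨ : Ψ.IsHomogeneous d) (c : k)
    (h : q - C c * bind₁ (fun i => X i - C (a i)) Ψ - V ^ 2 ∈ 𝔮 ^ (d + 1)) :
    homogeneousComponent d (bind₁ (fun i => X i + C (a i)) q) = C c * Ψ := by
  classical
  -- translate: `τ = (T ↦ T + a)` carries `𝔮` into `(T)`
  let χ : MvPolynomial σ k →+* MvPolynomial σ k :=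
    (bind₁ (fun i => X i + C (a i)) : MvPolynomial σ k →ₐ[k] MvPolynomial σ k).toRingHom
  have hχ : Ideal.map χ 𝔮 ≤ idealOfVars σ k := by
    rw [Ideal.map_le_iff_le_comap]
    intro f hf
    rw [Ideal.mem_comap]
    have h1 : idealOfVars σ k = idealOfVars σ k ^ 1 := (pow_one _).symm
    rw [h1, mem_pow_idealOfVars_iff']
    intro x hx
    have hx0 : x = 0 := by
      by_contra hne
      have : 1 ≤ x.degree := Nat.one_le_iff_ne_zero.mpr ((Finsupp.degree_eq_zero_iff x).not.mpr hne)
      omega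
    subst hx0
    change coeff 0 (bind₁ (fun i => X i + C (a i)) f) = 0
    rw [← constantCoeff_eq, ← eval_zero, eval_bind₁_translate, zero_add, hrat f hf]
  have hmem := Ideal.mem_map_of_mem χ h
  rw [Ideal.map_pow] at hmem
  have hmem' := Ideal.pow_right_mono hχ (d + 1) hmem
  -- `χ` of the congruence
  have hχeq : χ (q - C c * bind₁ (fun i => X i - C (a i)) Ψ - V ^ 2) =
      bind₁ (fun i => X i + C (a i)) q - C c * Ψ - (bind₁ (fun i => X i + C (a i)) V) ^ 2 := by
    change bind₁ (fun i => X i + C (a i)) (q - C c * bind₁ (fun i => X i - C (a i)) Ψ - V ^ 2) = _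
    rw [map_sub, map_sub, map_mul, map_pow, bind₁_C_right]
    congr 2
    rw [bind₁_bind₁]
    have : (fun i => bind₁ (fun i => X i + C (a i)) (X i - C (a i))) = (X : σ → MvPolynomial σ k) := by
      funext i
      rw [map_sub, bind₁_X_right, bind₁_C_right, add_sub_cancel_right]
    rw [this, bind₁_X_left, AlgHom.id_apply]
  rw [hχeq] at hmem'
  exact homogeneousComponent_eq_of_sq_congr_origin hd hΨ c hmem'

end Reading

end ReturnId

end Summit.ResolutionOfSingularities.ResolutionOfSingularities.Theorems.SwitchingDichotomy.ArithTransport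

end
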